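import Literature.MathematicalPhysics.QuantumFieldTheory.Balaban1983to89.Beta.RemainderHasMajQG1QInvTowerClosed
import Literature.MathematicalPhysics.QuantumFieldTheory.Balaban1983to89.Beta.RemainderHasMajQkAdjointTower
import Literature.MathematicalPhysics.QuantumFieldTheory.Balaban1983to89.Beta.RemainderOriginBaseLetters

/-!
# T. Bałaban, *Propagators for lattice gauge theories in a background field*, Commun. Math. Phys. **99** (1985) 389–434
# [Balaban1985BackgroundPropagators] (3.126) p. 420, (3.132)–(3.133) p. 422 with [Balaban1985Variational] (129) p. 297, (190) p. 308: **THE (3.133)-SHAPE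
# MAJORANT OF `H₁,k(U) = G₁,k(U)Q_k(U)†(Q_k(U)G₁,k(U)Q_k(U)†)⁻¹` ON NE9's TOWER BETWEEN THE SUP SIZES OF (190) (COARSE → FINE), AT ONE HEIGHT, FROM THE ONE
# ANALYTIC LETTER `hG0` — the `hH0` letter of row (D4)'s NODE D at the origin, every other input a tree theorem BY NAME**

CITATION HEADER (lean-in-tree rule 2026-08-18).  Sources: [Balaban1985BackgroundPropagators] (B9 = [5] of [15]; held `paper:balaban1985-cmp99-background-propagators`,
journal page = PDF page + 388): (3.126) p. 420 *«H B = GQ*(QGQ*)⁻¹B»*, (3.132)–(3.133) p. 422 (*«… can be analyzed in the same way as the operator (Q′G′²Q′*)⁻¹.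
We will not repeat these considerations here»*, then (3.132), (3.133) *«These inequalities are for the operator H given by the formula (3.126)»*), p. 423
*«From (3.129) and (3.132) with G₁ instead of G we get the inequalities (3.133) for H₁»*, Thm 3.3 (3.42) p. 397, (3.15)–(3.16) p. 393, (3.26) p. 395, Thm 3.11
p. 416; [Balaban1985Variational] (B11 = [15]; `paper:balaban1985-cmp102-variational-background`, journal page = PDF page + 276): (129) p. 297 (*«For the operator
Δ_a⁻¹ = G we have proved Theorem 3.3 in [5], and especially the bounds (3.42)»*; *«… satisfies the bound (3.133) [5]»*), (45) p. 285, (110) p. 294, (190) p. 308;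
[Balaban1984PropagatorsII] (B6) (2.51)–(2.52) p. 232, (2.54) p. 233, Lemma 2.1 (2.61) p. 234.  [15] pp. 297, 306–308 and [5] pp. 420–423 re-read this generation in
the held text layers; the other loci as printed in the headers of the tree files consumed.

WHY THIS FILE (audit cell `pub-balaban`, BINDER row (D4), OWNER lineage `b2b-balaban-beta-an4`, gen 111; journal [AN4-G111-INTENT-1]).  V79
`Beta.RemainderOriginTwoLetters.ineq190_origin_of_two_letters` assembles NODE D at the origin in a background from TWO analytic letters, `hG0` ([5] Thm 3.3 (3.42),
first entry, for the bond Green's function) and `hInv₀` (the (3.132)-shape bound of `(QG₀Q*)⁻¹`), plus structural letters.  On NE9's tower (`Ω_k = T_η`; carriers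
`BondL2K ℂ d (towerP L m (n+1)) c₀ W` → `BondL2K ℂ d m c₁ W`, operators `B9Eq326OperatorTower.laplaceAk` ∕ `QkW` ∕ `G1k`, `B11Eq103H1Complex.KinvLatticeK`) the
structural letters are tree theorems by name since gen 110: `hInv₀` = «Y4a» `Beta.RemainderHasMajQG1QInvTowerClosed.exists_hasMaj_Kinv_tower_sup` ((FCLK)), `hQ` =
«Y4b» `Beta.RemainderHasMajQkTower.hasMaj_QkW_tower_sup`, `hQs` = «Y4c» `Beta.RemainderHasMajQkAdjointTower.hasMaj_adjoint_QkW_tower_sup_diagonal`, `hJ` = «Y4b» §5.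
THIS FILE is the first half of the (D4) capstone (memo `FLAT-LETTERS-LOCATED.md` §21 (v)): the `hH0` letter.
* §1 **`hasMaj_H1_tower_sup`** — at ONE height `n`, in a summable regularity regime `Σ_{j<n+1} α_j ≤ A`, on the diagonal `c₀(L^{n+1})^d = c₁`: from
  `hG0 : HasMaj S^{fine}_m S^{fine}_m ((e∘G₁,k∘e⁻¹)↾ℝ) (B₀·e^{−δ₀·d_∞})` (DISPLAYED — the one analytic letter) and `hInv₀ : HasMaj S^{coarse}_m S^{coarse}_m
  ((e′∘(Q_kG₁,kQ_k†)⁻¹∘e′⁻¹)↾ℝ) (A′·e^{−r₁·d_∞})` (displayed here at one height; supplied ∃-first by «Y4a»), and the row sum (2.61) at a rate `σ` with constant `c`: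
  `HasMaj S^{coarse}_m S^{fine}_m ((e ∘ G₁,kQ_k†(Q_kG₁,kQ_k†)⁻¹ ∘ e′⁻¹)↾ℝ) (B₀·ν_{Q†}·e^{δ₀}·A′·c·e^{−ρ·d})` for `0 ≤ ρ ≤ r₁∕d`, `ρ + σ ≤ δ₀∕d`,
  `ν_{Q†} = M†·e·K_d(1)`, `M† = M_φ′e^{100d(d+1)L^dA}M_φ·2d` — `Beta.RemainderOriginBaseLetters.hasMaj_H0_of_base_letters` with `Q* :=` «Y4c», `J := 1` («Y4b» §5),
  rates read in the geometry's `d₁ ≤ d·d_∞`; the operator IS `B9Eq326OperatorTower.H1k` (`B11Eq103H1Complex.H1LatticeK_eq`, `rfl`) when `Q_k` onto is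
  discharged by `QkW_surjective`.
* §2 **`inverse_relations`**, **`h1_conj_eq`** — the four invertibility relations `G₁,kΔ_{a,k} = 1 = Δ_{a,k}G₁,k`, `(Q_kG₁,kQ_k†)⁻¹(Q_kG₁,kQ_k†) = 1 =
  (Q_kG₁,kQ_k†)(Q_kG₁,kQ_k†)⁻¹` read on the function carriers as continuous linear maps (finite dimension), and `H₁,k` conjugated = `G₀Q*·Inv₀·1` — the
  structural inputs of V77 `exists_newG_supSize` ∕ V79 `exists_invQGQ_supSize` ∕ `ineq190_origin_of_two_letters` for the sequel `Beta.RemainderOriginTower`.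
LETTER TABLE of V79 on NE9's tower after this file: `hG0` OPEN (NE9 plan v11; the END (K64) `B9Eq326G1kSupRowClosed.exists_local_letter_G1k`, ne9-leaf-05, in
preparation — its pointwise row converts to `hG0` by `Beta.RemainderHasMajGreenPrime.hasMaj_supSize_of_local` at `X := Bond d (towerP L m (n+1))`); `hD2`
((3.137) `Δ⁽²⁾` on NE9's carriers — NODE-O-class identification, `= 0` at `U = 1`) and the numerics displayed; everything else BY NAME.

HONEST SCOPE.  [folklore] compositions BY NAME; NO estimate of [5] ∕ [15] is proved here; `hG0`, `hInv₀` are hypotheses of the printed SHAPE at one height;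
the constants are the cell's crude ones, absorbed in print's *«O(1)»*; nothing identifies Bałaban's step-`k` objects with tree terms beyond NE9's `Ω_k = T_η`
tower (NODE O FROZEN (0)).  Row (D4) class UNCHANGED (instance 0∕1; D4 DISCHARGE NO DATE); NOT B12 Thm 2, NOT BetaPertH, NOT continuum, NOT Clay.  HONEST
DEPENDENCY (cell line): continuum YM on T⁴ ⇐ BetaPertH ∧ nine spine estimates (0/9 proved); BetaPertH ⇐ (D1) ∧ (D4) ∧ CAP+tail; G-an2-4 gates asym, D1 and
NE2/3/4.  NEW file importing «Y4a», «Y4c» (hence «Y4b») and `Beta.RemainderOriginBaseLetters` (all built); nothing modified; 0 `def`; standard axioms; no `sorry`.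
Net new unproved facts: 0.
-/

noncomputable section

open scoped BigOperators InnerProductSpace ComplexConjugate

namespace Literature.MathematicalPhysics.QuantumFieldTheory.Balaban1983to89.Beta.RemainderHasMajH1kTower

open B11SectG B11SupSize190 B11Reparam190
open B4Sect5Torus (TSite tdist ccoord tdist_nonneg tdist_symm)
open B4Sect5Proof (latticeConst)
open B5TorusCover (UT)
open B9Thm34Ext (toB6)
open B9Thm37GlueTorus (torusGeom tdist1 htri_torusGeom torusSum_tdist1_le)
open B9SectCLatticeCarrier (Bond bpos)
open B9Eq311L2Pairing (WL2)
open B9Eq319QprimeTorus (fineP blockCoord)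
open B9Eq315QTower (towerP UlevOf)
open B9Eq315QTorus (perCfg cornerSite)
open B9Eq316TowerFlatIsOneStep (siteCast towerP_eq_fineP_pow)
open B7Prop1Explicit (U1 Wcx boxVec)
open B11Eq103H1Complex (BondL2K KinvLatticeK)
open B9Eq326OperatorTower (laplaceAk QkW G1k)
open Beta.RemainderOriginBaseLetters (hasMaj_H0_of_base_letters)
open Beta.RemainderHasMajQkTower (hasMaj_QkW_tower_sup kernelQ_nonneg kernelQ_loc kernelQ_rowSum kernelQ_colSum hasMaj_supSize_id
  kernelId_nonneg kernelId_loc kernelId_colSum)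
open Beta.RemainderHasMajQkAdjointTower (hasMaj_adjoint_QkW_tower_sup_diagonal)

/-! ### Torus bookkeeping (private) -/

section Aux

variable {d : ℕ} {m : Fin d → ℕ}

/-- `ofSite a = y ↔ a = toSite y`. [folklore] -/
private theorem ofSite_eq_iff (a : TSite d m) (y : UT m) : UT.ofSite m a = y ↔ a = UT.toSite m y := by
  constructor
  · rintro rfl; rfl
  · rintro rfl; rfl

/-- The boxes of the coarse bond-position map are its fibres. [folklore] -/
private theorem mem_boxBond_iff (y : UT m) (c : Bond d m) :
    c ∈ (Finset.univ.filter fun c : Bond d m => bpos c = UT.toSite m y) ↔ UT.ofSite m (bpos c) = y := by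
  rw [Finset.mem_filter, ofSite_eq_iff]
  simp

/-- The boxes of the fine-bond big-block map are its fibres. [folklore] -/
private theorem mem_boxFine_iff {L : ℕ} [NeZero L] {n : ℕ} (y : UT m) (b : Bond d (towerP L m (n + 1))) :
    b ∈ (Finset.univ.filter fun b : Bond d (towerP L m (n + 1)) =>
        blockCoord (L ^ (n + 1)) m (siteCast (towerP_eq_fineP_pow L m (n + 1)) (bpos b)) = UT.toSite m y) ↔
      UT.ofSite m (blockCoord (L ^ (n + 1)) m (siteCast (towerP_eq_fineP_pow L m (n + 1)) (bpos b))) = y := by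
  rw [Finset.mem_filter, ofSite_eq_iff]
  simp

variable [∀ i, NeZero (m i)]

/-- `d₁ ≤ d·d_∞` on the torus of blocks. [folklore] -/
private theorem tdist1_le_mul_tdist (y v : UT m) :
    tdist1 m y v ≤ d * tdist m (UT.toSite m y) (UT.toSite m v) := by
  unfold tdist1 tdist
  have h : ∀ i ∈ (Finset.univ : Finset (Fin d)),
      ((ccoord m (UT.toSite m y) (UT.toSite m v) i : ℕ) : ℝ) ≤
        ((Finset.univ.sup (ccoord m (UT.toSite m y) (UT.toSite m v)) : ℕ) : ℝ) :=
    fun i hi => by exact_mod_cast Finset.le_sup (f := ccoord m (UT.toSite m y) (UT.toSite m v)) hi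
  calc ∑ i, ((ccoord m (UT.toSite m y) (UT.toSite m v) i : ℕ) : ℝ)
      ≤ ∑ _i : Fin d, ((Finset.univ.sup (ccoord m (UT.toSite m y) (UT.toSite m v)) : ℕ) : ℝ) :=
        Finset.sum_le_sum h
    _ = d * ((Finset.univ.sup (ccoord m (UT.toSite m y) (UT.toSite m v)) : ℕ) : ℝ) := by
        rw [Finset.sum_const, Finset.card_univ, Fintype.card_fin, nsmul_eq_mul]

/-- `e^{−r·d_∞} ≤ e^{−(r/d)·d₁}` for `r ≥ 0`. [folklore] -/
private theorem exp_tdist_le_exp_tdist1 {r : ℝ} (hr : 0 ≤ r) (η₀ L₀ M₀ R : ℝ) (H : Prop) (y v : UT m) :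
    Real.exp (-(r * tdist m (UT.toSite m y) (UT.toSite m v))) ≤
      Real.exp (-(r / d * (toB6 (torusGeom m η₀ L₀ M₀) R H).dist y v)) := by
  refine Real.exp_le_exp.mpr (neg_le_neg ?_)
  show r / d * tdist1 m y v ≤ _
  have h1 := tdist1_le_mul_tdist y v
  have ht : 0 ≤ tdist m (UT.toSite m y) (UT.toSite m v) := tdist_nonneg _ _ _
  rcases Nat.eq_zero_or_pos d with hd | hd
  · subst hd
    simp only [Nat.cast_zero, div_zero, zero_mul]
    exact mul_nonneg hr ht
  · have hd' : (0 : ℝ) < d := by exact_mod_cast hd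
    calc r / d * tdist1 m y v ≤ r / d * (d * tdist m (UT.toSite m y) (UT.toSite m v)) :=
          mul_le_mul_of_nonneg_left h1 (div_nonneg hr hd'.le)
      _ = r * tdist m (UT.toSite m y) (UT.toSite m v) := by
          field_simp

end Aux

/-! ## §1  The `hH0` letter at ONE height: `H₁,k = G₁,kQ_k†(Q_kG₁,kQ_k†)⁻¹` coarse-sup → fine-sup from `hG0`, `hInv₀`, «Y4c»'s `Q_k†` letter and «Y4b»'s identity letter -/

section OneHeight

variable {d : ℕ} (L : ℕ) [NeZero L] (m : Fin d → ℕ) [∀ i, NeZero (m i)] (n : ℕ)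
  {𝔸 : Type*} [NormedRing 𝔸] [NormedAlgebra ℂ 𝔸] [CompleteSpace 𝔸] [NormOneClass 𝔸] [StarRing 𝔸] [StarModule ℂ 𝔸]
  {W : Type} [NormedAddCommGroup W] [InnerProductSpace ℂ W] [FiniteDimensional ℂ W] (φ : W ≃ₗ[ℂ] 𝔸) {c₀ c₁ : ℝ}
  [Fact (0 < c₀)] [Fact (0 < c₁)] (η : ℝ)
  (U : Bond d (towerP L m (n + 1)) → 𝔸ˣ) (hL : 1 ≤ L) (α : ℕ → ℝ) (hα0 : ∀ j, 0 ≤ α j) (hα1 : ∀ j, α j ≤ 1 / 64)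
  (hU1 : ∀ (j : ℕ) (x : B7Prop1Explicit.Site d) (κ : Fin d), perCfg (towerP L m (j + 1)) (UlevOf L m (n + 1) U j) x κ ∈ U1 𝔸)
  (hreg : ∀ (j : ℕ) (y : TSite d (towerP L m j)) (κ : Fin d) (r : Fin d → Fin L),
    ‖((Wcx L (perCfg (towerP L m (j + 1)) (UlevOf L m (n + 1) U j)) (cornerSite L y) κ (boxVec L r) : 𝔸ˣ) : 𝔸) - 1‖ ≤ α j)
  {Mφ Mφ' : ℝ} (hMφ : 0 ≤ Mφ) (hφ : ∀ w, ‖φ w‖ ≤ Mφ * ‖w‖) (hMφ' : 0 ≤ Mφ') (hφ' : ∀ X, ‖φ.symm X‖ ≤ Mφ' * ‖X‖)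
  (τ : 𝔸 →ₗ[ℂ] ℂ) {a : ℝ}
  (hpos : ∀ x : BondL2K ℂ d (towerP L m (n + 1)) c₀ W, x ≠ 0 →
    0 < RCLike.re ⟪x, laplaceAk L m n φ η U hL α hα1 hU1 hreg τ (c₀ := c₀) (c₁ := c₁) a x⟫_ℂ)
  (hQ : Function.Surjective (QkW L m n φ U hL α hα1 hU1 hreg (c₀ := c₀) (c₁ := c₁)))
  (η₀ L₀ M₀ R : ℝ) (H : Prop)

include hα0 hMφ hφ hMφ' hφ' in
/-- **THE (3.133)-SHAPE MAJORANT OF `H₁,k(U) = G₁,k(U)Q_k(U)†(Q_k(U)G₁,k(U)Q_k(U)†)⁻¹` ON NE9's TOWER, COARSE-SUP → FINE-SUP, AT ONE HEIGHT** ([5] p. 422: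
*«The above inequality [(3.132)] together with Theorem 3.3 for G … give (3.133)»*, p. 423 *«with G₁ instead of G … (3.133) for H₁»*; [15] (129)).  Height `n`, period
`m`, background `U` with the regularity display `α` (`hU1`, `hreg`) in the summable regime `Σ_{j<n+1} α_j ≤ A`, diagonal weights `c₀(L^{n+1})^d = c₁`, the (190)
sup sizes over the torus of blocks `T_m` (fine bonds blocked by `blockCoord (L^(n+1)) m ∘ siteCast ∘ bpos`, coarse bonds by `bpos`).  GIVEN `hG0` (the height-free sup
row of `G₁,k(U) = Δ_{a,k}(U)⁻¹`: majorant `B₀e^{−δ₀d_∞}` fine → fine — THE analytic letter, [5] Thm 3.3 (3.42) first entry) and `hInv0` (`(Q_kG₁,kQ_k†)⁻¹`: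
`A′e^{−r₁d_∞}` coarse → coarse — «Y4a» supplies it ∃-first), the row sum (2.61) at the rate `σ ≥ 0` with constant `c`, and `0 ≤ ρ ≤ r₁∕d`, `ρ + σ ≤ δ₀∕d`:
`G₁,kQ_k†(Q_kG₁,kQ_k†)⁻¹` (conjugated to the function carriers, real restriction) has the majorant `B₀·(M†·e·K_d(1))·e^{δ₀}·A′·c·e^{−ρ·d}` from `S^{coarse}_m`
into `S^{fine}_m`, `M† = M_φ′e^{100d(d+1)L^dA}M_φ·2d` («Y4c»'s adjoint-averaging constant), `K_d(1) = B4Sect5Proof.latticeConst d 1` — by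
`Beta.RemainderOriginBaseLetters.hasMaj_H0_of_base_letters` with `Q* :=` «Y4c» `hasMaj_adjoint_QkW_tower_sup_diagonal` (range `d`, column sums `M†eK_d(1)`:
«Y4b» §3), `J := 1` («Y4b» §5 `hasMaj_supSize_id`), the two analytic letters read in the geometry's distance `d₁ ≤ d·d_∞` (rates `δ₀∕d`, `r₁∕d`).
[cite: Balaban1985BackgroundPropagators, (3.126) p.420, (3.132)–(3.133) p.422, p.423, Thm 3.3 (3.42) p.397] [cite: Balaban1985Variational, (129) p.297, (190) p.308]
[cite: Balaban1984PropagatorsII, (2.51)–(2.52) p.232, (2.54) p.233, Lemma 2.1 (2.61) p.234] -/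
theorem hasMaj_H1_tower_sup (hd : 1 ≤ d) (hm : ∀ i, 1 ≤ m i) (hw : c₀ * ((L : ℝ) ^ (n + 1)) ^ d = c₁) {A : ℝ}
    (hA : ∑ j ∈ Finset.range (n + 1), α j ≤ A)
    {B₀ δ₀ A' r₁ ρ σ c : ℝ} (hB₀ : 0 ≤ B₀) (hδ₀ : 0 ≤ δ₀) (hA' : 0 ≤ A') (hr₁ : 0 ≤ r₁)
    (hrow : RowSum (toB6 (torusGeom m η₀ L₀ M₀) R H) σ c) (hσ : 0 ≤ σ) (hρ : 0 ≤ ρ) (hρI : ρ ≤ r₁ / d)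
    (hρ₁ : ρ + σ ≤ δ₀ / d)
    (hG0 : HasMaj
      (supSize (toB6 (torusGeom m η₀ L₀ M₀) R H)
        (fun y => Finset.univ.filter fun b : Bond d (towerP L m (n + 1)) =>
          blockCoord (L ^ (n + 1)) m (siteCast (towerP_eq_fineP_pow L m (n + 1)) (bpos b)) = UT.toSite m y)
        (fun b => UT.ofSite m (blockCoord (L ^ (n + 1)) m (siteCast (towerP_eq_fineP_pow L m (n + 1)) (bpos b)))) :
          BlockNorm (toB6 (torusGeom m η₀ L₀ M₀) R H) (Bond d (towerP L m (n + 1)) → W))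
      (supSize (toB6 (torusGeom m η₀ L₀ M₀) R H)
        (fun y => Finset.univ.filter fun b : Bond d (towerP L m (n + 1)) =>
          blockCoord (L ^ (n + 1)) m (siteCast (towerP_eq_fineP_pow L m (n + 1)) (bpos b)) = UT.toSite m y)
        (fun b => UT.ofSite m (blockCoord (L ^ (n + 1)) m (siteCast (towerP_eq_fineP_pow L m (n + 1)) (bpos b)))))
      (((WL2.linearEquiv ℂ ℂ (fun _ : Bond d (towerP L m (n + 1)) => c₀) :
            BondL2K ℂ d (towerP L m (n + 1)) c₀ W ≃ₗ[ℂ] (Bond d (towerP L m (n + 1)) → W)).toLinearMap ∘ₗ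
          G1k L m n φ η U hL α hα1 hU1 hreg τ (c₀ := c₀) (c₁ := c₁) hpos ∘ₗ
          (WL2.linearEquiv ℂ ℂ (fun _ : Bond d (towerP L m (n + 1)) => c₀) :
            BondL2K ℂ d (towerP L m (n + 1)) c₀ W ≃ₗ[ℂ] (Bond d (towerP L m (n + 1)) → W)).symm.toLinearMap).restrictScalars ℝ)
      (fun y v => B₀ * Real.exp (-(δ₀ * tdist m (UT.toSite m y) (UT.toSite m v)))))
    (hInv0 : HasMaj
      (supSize (toB6 (torusGeom m η₀ L₀ M₀) R H)
        (fun y => Finset.univ.filter fun c : Bond d m => bpos c = UT.toSite m y)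
        (fun c => UT.ofSite m (bpos c)) : BlockNorm (toB6 (torusGeom m η₀ L₀ M₀) R H) (Bond d m → W))
      (supSize (toB6 (torusGeom m η₀ L₀ M₀) R H)
        (fun y => Finset.univ.filter fun c : Bond d m => bpos c = UT.toSite m y)
        (fun c => UT.ofSite m (bpos c)))
      (((WL2.linearEquiv ℂ ℂ (fun _ : Bond d m => c₁) : BondL2K ℂ d m c₁ W ≃ₗ[ℂ] (Bond d m → W)).toLinearMap ∘ₗ
          KinvLatticeK hpos hQ ∘ₗ
          (WL2.linearEquiv ℂ ℂ (fun _ : Bond d m => c₁) : BondL2K ℂ d m c₁ W ≃ₗ[ℂ] (Bond d m → W)).symm.toLinearMap).restrictScalars ℝ)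
      (fun y v => A' * Real.exp (-(r₁ * tdist m (UT.toSite m y) (UT.toSite m v))))) :
    HasMaj
      (supSize (toB6 (torusGeom m η₀ L₀ M₀) R H)
        (fun y => Finset.univ.filter fun c : Bond d m => bpos c = UT.toSite m y)
        (fun c => UT.ofSite m (bpos c)) : BlockNorm (toB6 (torusGeom m η₀ L₀ M₀) R H) (Bond d m → W))
      (supSize (toB6 (torusGeom m η₀ L₀ M₀) R H)
        (fun y => Finset.univ.filter fun b : Bond d (towerP L m (n + 1)) =>
          blockCoord (L ^ (n + 1)) m (siteCast (towerP_eq_fineP_pow L m (n + 1)) (bpos b)) = UT.toSite m y)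
        (fun b => UT.ofSite m (blockCoord (L ^ (n + 1)) m (siteCast (towerP_eq_fineP_pow L m (n + 1)) (bpos b)))) :
          BlockNorm (toB6 (torusGeom m η₀ L₀ M₀) R H) (Bond d (towerP L m (n + 1)) → W))
      (((WL2.linearEquiv ℂ ℂ (fun _ : Bond d (towerP L m (n + 1)) => c₀) :
            BondL2K ℂ d (towerP L m (n + 1)) c₀ W ≃ₗ[ℂ] (Bond d (towerP L m (n + 1)) → W)).toLinearMap ∘ₗ
          (G1k L m n φ η U hL α hα1 hU1 hreg τ (c₀ := c₀) (c₁ := c₁) hpos ∘ₗ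
            LinearMap.adjoint (QkW L m n φ U hL α hα1 hU1 hreg (c₀ := c₀) (c₁ := c₁)) ∘ₗ KinvLatticeK hpos hQ) ∘ₗ
          (WL2.linearEquiv ℂ ℂ (fun _ : Bond d m => c₁) : BondL2K ℂ d m c₁ W ≃ₗ[ℂ] (Bond d m → W)).symm.toLinearMap).restrictScalars ℝ)
      (fun y v => B₀ * ((Mφ' * Real.exp (100 * d * (d + 1) * (L : ℝ) ^ d * A) * Mφ * ((2 * d : ℕ) : ℝ)) * Real.exp 1 *
          latticeConst d 1) * Real.exp δ₀ * A' * c *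
        Real.exp (-(ρ * (toB6 (torusGeom m η₀ L₀ M₀) R H).dist y v))) := by
  have hd0 : (d : ℝ) ≠ 0 := Nat.cast_ne_zero.mpr (by omega)
  have htri := htri_torusGeom (N := m) η₀ L₀ M₀ R H
  have hdist : ∀ y v : (toB6 (torusGeom m η₀ L₀ M₀) R H).Site, 0 ≤ (toB6 (torusGeom m η₀ L₀ M₀) R H).dist y v :=
    fun y v => B9Thm37GlueTorus.tdist1_nonneg y v
  -- the two analytic letters in the geometry's distance
  have hG0' := hG0.mono fun y v => mul_le_mul_of_nonneg_left (exp_tdist_le_exp_tdist1 hδ₀ η₀ L₀ M₀ R H y v) hB₀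
  have hInv0' := hInv0.mono fun y v => mul_le_mul_of_nonneg_left (exp_tdist_le_exp_tdist1 hr₁ η₀ L₀ M₀ R H y v) hA'
  -- the adjoint averaging (Y4c) and its kernel (Y4b §3)
  have hM : 0 ≤ Mφ' * Real.exp (100 * d * (d + 1) * (L : ℝ) ^ d * A) * Mφ * ((2 * d : ℕ) : ℝ) := by positivity
  have hQs := hasMaj_adjoint_QkW_tower_sup_diagonal L m n φ U hL α hα0 hα1 hU1 hreg hMφ hφ hMφ' hφ' η₀ L₀ M₀ R H
    (c₀ := c₀) (c₁ := c₁) hm hw hA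
  -- the identity letter (Y4b §5)
  letI : DecidableEq (toB6 (torusGeom m η₀ L₀ M₀) R H).Site := inferInstanceAs (DecidableEq (UT m))
  have hJ := hasMaj_supSize_id (g := toB6 (torusGeom m η₀ L₀ M₀) R H) (E := W)
    (box := fun y => Finset.univ.filter fun c : Bond d m => bpos c = UT.toSite m y)
    (blk := fun c => UT.ofSite m (bpos c)) (fun y c => mem_boxBond_iff y c)
  refine HasMaj.mono (hasMaj_H0_of_base_letters
    (bB := (supSize (toB6 (torusGeom m η₀ L₀ M₀) R H)
        (fun y => Finset.univ.filter fun c : Bond d m => bpos c = UT.toSite m y)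
        (fun c => UT.ofSite m (bpos c)) : BlockNorm (toB6 (torusGeom m η₀ L₀ M₀) R H) (Bond d m → W)))
    (J := LinearMap.id) htri hdist hrow hB₀ hA'
    (mul_nonneg (mul_nonneg hM (Real.exp_nonneg 1)) (B4Sect5Proof.latticeConst_nonneg d zero_le_one)) zero_le_one hρ hσ hρI
    hρ₁ ?hdef hG0'
    (fun y v => kernelQ_nonneg m hM y v) (fun y v h => kernelQ_loc m η₀ L₀ M₀ R H y v h) (kernelQ_colSum m hM hm) hQs hInv0'
    (kernelId_nonneg m) (fun y v h => kernelId_loc m η₀ L₀ M₀ R H y v h) (kernelId_colSum m) hJ) (fun y v => le_of_eq ?heq)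
  case hdef =>
    apply LinearMap.ext
    intro v
    simp only [LinearMap.coe_restrictScalars, LinearMap.coe_comp, Function.comp_apply, LinearEquiv.coe_coe,
      LinearEquiv.symm_apply_apply, LinearMap.id_coe, id_eq]
  case heq => simp only [supSize_κ, one_mul, mul_one, mul_zero, Real.exp_zero, div_mul_cancel₀ _ hd0]


/-! ## §2  Structural inputs of V77 ∕ V79 on the tower: the invertibility relations and `H₁,k` as `G₀Q*·Inv₀·1` -/

/-- **THE FOUR INVERTIBILITY RELATIONS ON THE FUNCTION CARRIERS.**  `G₁,k = Δ_{a,k}(U)⁻¹` and `(Q_kG₁,kQ_k†)⁻¹`, conjugated by the identifications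
`WL2.linearEquiv` and read as continuous linear maps (finite dimension): `G₁Δ_a = 1 = Δ_aG₁`, `(Q_kG₁Q_k†)⁻¹·(Q_kG₁Q_k†) = 1 = (Q_kG₁Q_k†)·(Q_kG₁Q_k†)⁻¹` —
automatic from the constructions `B11Eq103H1Complex.G1K` ∕ `KinvK` (`greenK`: `G1K_laplaceAK`, `laplaceAK_G1K`, `greenK_apply`, `hK_lattice`); the `hleft` ∕
`hright` inputs of V77 `Beta.RemainderOriginBaseLetters.exists_newG_supSize` and V79 `Beta.RemainderOriginTwoLetters.exists_invQGQ_supSize` on NE9's tower.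
[folklore] [cite: Balaban1985Variational, (45) p.285, (110) p.294] [cite: Balaban1985BackgroundPropagators, (3.26) p.395, Thm 3.11 p.416, (3.126) p.420] -/
theorem inverse_relations :
    LinearMap.toContinuousLinearMap
          ((WL2.linearEquiv ℂ ℂ (fun _ : Bond d (towerP L m (n + 1)) => c₀) :
            BondL2K ℂ d (towerP L m (n + 1)) c₀ W ≃ₗ[ℂ] (Bond d (towerP L m (n + 1)) → W)).toLinearMap ∘ₗ
            G1k L m n φ η U hL α hα1 hU1 hreg τ (c₀ := c₀) (c₁ := c₁) hpos ∘ₗ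
            (WL2.linearEquiv ℂ ℂ (fun _ : Bond d (towerP L m (n + 1)) => c₀) :
            BondL2K ℂ d (towerP L m (n + 1)) c₀ W ≃ₗ[ℂ] (Bond d (towerP L m (n + 1)) → W)).symm.toLinearMap) *
        LinearMap.toContinuousLinearMap
          ((WL2.linearEquiv ℂ ℂ (fun _ : Bond d (towerP L m (n + 1)) => c₀) :
            BondL2K ℂ d (towerP L m (n + 1)) c₀ W ≃ₗ[ℂ] (Bond d (towerP L m (n + 1)) → W)).toLinearMap ∘ₗ
            laplaceAk L m n φ η U hL α hα1 hU1 hreg τ (c₀ := c₀) (c₁ := c₁) a ∘ₗ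
            (WL2.linearEquiv ℂ ℂ (fun _ : Bond d (towerP L m (n + 1)) => c₀) :
            BondL2K ℂ d (towerP L m (n + 1)) c₀ W ≃ₗ[ℂ] (Bond d (towerP L m (n + 1)) → W)).symm.toLinearMap) = 1 ∧
      LinearMap.toContinuousLinearMap
          ((WL2.linearEquiv ℂ ℂ (fun _ : Bond d (towerP L m (n + 1)) => c₀) :
            BondL2K ℂ d (towerP L m (n + 1)) c₀ W ≃ₗ[ℂ] (Bond d (towerP L m (n + 1)) → W)).toLinearMap ∘ₗ
            laplaceAk L m n φ η U hL α hα1 hU1 hreg τ (c₀ := c₀) (c₁ := c₁) a ∘ₗ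
            (WL2.linearEquiv ℂ ℂ (fun _ : Bond d (towerP L m (n + 1)) => c₀) :
            BondL2K ℂ d (towerP L m (n + 1)) c₀ W ≃ₗ[ℂ] (Bond d (towerP L m (n + 1)) → W)).symm.toLinearMap) *
        LinearMap.toContinuousLinearMap
          ((WL2.linearEquiv ℂ ℂ (fun _ : Bond d (towerP L m (n + 1)) => c₀) :
            BondL2K ℂ d (towerP L m (n + 1)) c₀ W ≃ₗ[ℂ] (Bond d (towerP L m (n + 1)) → W)).toLinearMap ∘ₗ
            G1k L m n φ η U hL α hα1 hU1 hreg τ (c₀ := c₀) (c₁ := c₁) hpos ∘ₗ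
            (WL2.linearEquiv ℂ ℂ (fun _ : Bond d (towerP L m (n + 1)) => c₀) :
            BondL2K ℂ d (towerP L m (n + 1)) c₀ W ≃ₗ[ℂ] (Bond d (towerP L m (n + 1)) → W)).symm.toLinearMap) = 1 ∧
      LinearMap.toContinuousLinearMap
          ((WL2.linearEquiv ℂ ℂ (fun _ : Bond d m => c₁) : BondL2K ℂ d m c₁ W ≃ₗ[ℂ] (Bond d m → W)).toLinearMap ∘ₗ
            KinvLatticeK hpos hQ ∘ₗ
            (WL2.linearEquiv ℂ ℂ (fun _ : Bond d m => c₁) : BondL2K ℂ d m c₁ W ≃ₗ[ℂ] (Bond d m → W)).symm.toLinearMap) *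
        ((LinearMap.toContinuousLinearMap
          ((WL2.linearEquiv ℂ ℂ (fun _ : Bond d m => c₁) : BondL2K ℂ d m c₁ W ≃ₗ[ℂ] (Bond d m → W)).toLinearMap ∘ₗ
            QkW L m n φ U hL α hα1 hU1 hreg (c₀ := c₀) (c₁ := c₁) ∘ₗ
            (WL2.linearEquiv ℂ ℂ (fun _ : Bond d (towerP L m (n + 1)) => c₀) :
            BondL2K ℂ d (towerP L m (n + 1)) c₀ W ≃ₗ[ℂ] (Bond d (towerP L m (n + 1)) → W)).symm.toLinearMap)).comp
          ((LinearMap.toContinuousLinearMap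
          ((WL2.linearEquiv ℂ ℂ (fun _ : Bond d (towerP L m (n + 1)) => c₀) :
            BondL2K ℂ d (towerP L m (n + 1)) c₀ W ≃ₗ[ℂ] (Bond d (towerP L m (n + 1)) → W)).toLinearMap ∘ₗ
            G1k L m n φ η U hL α hα1 hU1 hreg τ (c₀ := c₀) (c₁ := c₁) hpos ∘ₗ
            (WL2.linearEquiv ℂ ℂ (fun _ : Bond d (towerP L m (n + 1)) => c₀) :
            BondL2K ℂ d (towerP L m (n + 1)) c₀ W ≃ₗ[ℂ] (Bond d (towerP L m (n + 1)) → W)).symm.toLinearMap)).comp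
            (LinearMap.toContinuousLinearMap
          ((WL2.linearEquiv ℂ ℂ (fun _ : Bond d (towerP L m (n + 1)) => c₀) :
            BondL2K ℂ d (towerP L m (n + 1)) c₀ W ≃ₗ[ℂ] (Bond d (towerP L m (n + 1)) → W)).toLinearMap ∘ₗ
            LinearMap.adjoint (QkW L m n φ U hL α hα1 hU1 hreg (c₀ := c₀) (c₁ := c₁)) ∘ₗ
            (WL2.linearEquiv ℂ ℂ (fun _ : Bond d m => c₁) : BondL2K ℂ d m c₁ W ≃ₗ[ℂ] (Bond d m → W)).symm.toLinearMap)))) = 1 ∧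
      ((LinearMap.toContinuousLinearMap
          ((WL2.linearEquiv ℂ ℂ (fun _ : Bond d m => c₁) : BondL2K ℂ d m c₁ W ≃ₗ[ℂ] (Bond d m → W)).toLinearMap ∘ₗ
            QkW L m n φ U hL α hα1 hU1 hreg (c₀ := c₀) (c₁ := c₁) ∘ₗ
            (WL2.linearEquiv ℂ ℂ (fun _ : Bond d (towerP L m (n + 1)) => c₀) :
            BondL2K ℂ d (towerP L m (n + 1)) c₀ W ≃ₗ[ℂ] (Bond d (towerP L m (n + 1)) → W)).symm.toLinearMap)).comp
          ((LinearMap.toContinuousLinearMap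
          ((WL2.linearEquiv ℂ ℂ (fun _ : Bond d (towerP L m (n + 1)) => c₀) :
            BondL2K ℂ d (towerP L m (n + 1)) c₀ W ≃ₗ[ℂ] (Bond d (towerP L m (n + 1)) → W)).toLinearMap ∘ₗ
            G1k L m n φ η U hL α hα1 hU1 hreg τ (c₀ := c₀) (c₁ := c₁) hpos ∘ₗ
            (WL2.linearEquiv ℂ ℂ (fun _ : Bond d (towerP L m (n + 1)) => c₀) :
            BondL2K ℂ d (towerP L m (n + 1)) c₀ W ≃ₗ[ℂ] (Bond d (towerP L m (n + 1)) → W)).symm.toLinearMap)).comp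
            (LinearMap.toContinuousLinearMap
          ((WL2.linearEquiv ℂ ℂ (fun _ : Bond d (towerP L m (n + 1)) => c₀) :
            BondL2K ℂ d (towerP L m (n + 1)) c₀ W ≃ₗ[ℂ] (Bond d (towerP L m (n + 1)) → W)).toLinearMap ∘ₗ
            LinearMap.adjoint (QkW L m n φ U hL α hα1 hU1 hreg (c₀ := c₀) (c₁ := c₁)) ∘ₗ
            (WL2.linearEquiv ℂ ℂ (fun _ : Bond d m => c₁) : BondL2K ℂ d m c₁ W ≃ₗ[ℂ] (Bond d m → W)).symm.toLinearMap)))) *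
        LinearMap.toContinuousLinearMap
          ((WL2.linearEquiv ℂ ℂ (fun _ : Bond d m => c₁) : BondL2K ℂ d m c₁ W ≃ₗ[ℂ] (Bond d m → W)).toLinearMap ∘ₗ
            KinvLatticeK hpos hQ ∘ₗ
            (WL2.linearEquiv ℂ ℂ (fun _ : Bond d m => c₁) : BondL2K ℂ d m c₁ W ≃ₗ[ℂ] (Bond d m → W)).symm.toLinearMap) = 1 := by
  have e1 : ∀ x, G1k L m n φ η U hL α hα1 hU1 hreg τ (c₀ := c₀) (c₁ := c₁) hpos
      (laplaceAk L m n φ η U hL α hα1 hU1 hreg τ (c₀ := c₀) (c₁ := c₁) a x) = x :=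
    fun x => B11Eq103H1Complex.G1K_laplaceAK hpos x
  have e2 : ∀ x, laplaceAk L m n φ η U hL α hα1 hU1 hreg τ (c₀ := c₀) (c₁ := c₁) a
      (G1k L m n φ η U hL α hα1 hU1 hreg τ (c₀ := c₀) (c₁ := c₁) hpos x) = x :=
    fun x => B11Eq103H1Complex.laplaceAK_G1K hpos x
  have e3 : ∀ y, QkW L m n φ U hL α hα1 hU1 hreg (c₀ := c₀) (c₁ := c₁)
      (G1k L m n φ η U hL α hα1 hU1 hreg τ (c₀ := c₀) (c₁ := c₁) hpos
        (LinearMap.adjoint (QkW L m n φ U hL α hα1 hU1 hreg (c₀ := c₀) (c₁ := c₁)) (KinvLatticeK hpos hQ y))) = y :=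
    fun y => B11Eq103H1Complex.hK_lattice hpos hQ y
  have e4 : ∀ y, KinvLatticeK hpos hQ (QkW L m n φ U hL α hα1 hU1 hreg (c₀ := c₀) (c₁ := c₁)
      (G1k L m n φ η U hL α hα1 hU1 hreg τ (c₀ := c₀) (c₁ := c₁) hpos
        (LinearMap.adjoint (QkW L m n φ U hL α hα1 hU1 hreg (c₀ := c₀) (c₁ := c₁)) y))) = y :=
    fun y => B11Eq103H1Complex.greenK_apply
      (T := QkW L m n φ U hL α hα1 hU1 hreg (c₀ := c₀) (c₁ := c₁) ∘ₗ G1k L m n φ η U hL α hα1 hU1 hreg τ (c₀ := c₀) (c₁ := c₁) hpos ∘ₗ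
        LinearMap.adjoint (QkW L m n φ U hL α hα1 hU1 hreg (c₀ := c₀) (c₁ := c₁)))
      (B11Eq103H1Complex.re_inner_KK_pos hpos B11Eq103H1Complex.hadj_adjoint
        (B11Eq103H1Complex.adjoint_injective_of_surjective _ hQ)) y
  refine ⟨ContinuousLinearMap.ext fun f => ?_, ContinuousLinearMap.ext fun f => ?_, ContinuousLinearMap.ext fun g => ?_,
    ContinuousLinearMap.ext fun g => ?_⟩
  · simp only [mul_apply_eq_comp, one_apply_eq_self, LinearMap.coe_toContinuousLinearMap', LinearMap.coe_comp, Function.comp_apply,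
      LinearEquiv.coe_coe, LinearEquiv.symm_apply_apply, e1, LinearEquiv.apply_symm_apply]
  · simp only [mul_apply_eq_comp, one_apply_eq_self, LinearMap.coe_toContinuousLinearMap', LinearMap.coe_comp, Function.comp_apply,
      LinearEquiv.coe_coe, LinearEquiv.symm_apply_apply, e2, LinearEquiv.apply_symm_apply]
  · simp only [mul_apply_eq_comp, one_apply_eq_self, ContinuousLinearMap.comp_apply, LinearMap.coe_toContinuousLinearMap',
      LinearMap.coe_comp, Function.comp_apply, LinearEquiv.coe_coe, LinearEquiv.symm_apply_apply, e4, LinearEquiv.apply_symm_apply]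
  · simp only [mul_apply_eq_comp, one_apply_eq_self, ContinuousLinearMap.comp_apply, LinearMap.coe_toContinuousLinearMap',
      LinearMap.coe_comp, Function.comp_apply, LinearEquiv.coe_coe, LinearEquiv.symm_apply_apply, e3, LinearEquiv.apply_symm_apply]

/-- **`H₁,k = G₁,kQ_k†(Q_kG₁,kQ_k†)⁻¹` CONJUGATED TO THE FUNCTION CARRIERS IS V79's `H₀ = G₀Q*·Inv₀·J` WITH `J = 1`** (the inner identifications cancel) —
the `hH0def` input of `Beta.RemainderOriginTwoLetters.ineq190_origin_of_two_letters` on NE9's tower. [folklore] [cite: Balaban1985Variational, (129) p.297]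
[cite: Balaban1985BackgroundPropagators, (3.126) p.420] -/
theorem h1_conj_eq :
    (((WL2.linearEquiv ℂ ℂ (fun _ : Bond d (towerP L m (n + 1)) => c₀) :
            BondL2K ℂ d (towerP L m (n + 1)) c₀ W ≃ₗ[ℂ] (Bond d (towerP L m (n + 1)) → W)).toLinearMap ∘ₗ
        (G1k L m n φ η U hL α hα1 hU1 hreg τ (c₀ := c₀) (c₁ := c₁) hpos ∘ₗ
          LinearMap.adjoint (QkW L m n φ U hL α hα1 hU1 hreg (c₀ := c₀) (c₁ := c₁)) ∘ₗ KinvLatticeK hpos hQ) ∘ₗ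
        (WL2.linearEquiv ℂ ℂ (fun _ : Bond d m => c₁) : BondL2K ℂ d m c₁ W ≃ₗ[ℂ] (Bond d m → W)).symm.toLinearMap).restrictScalars ℝ) =
      (((((WL2.linearEquiv ℂ ℂ (fun _ : Bond d (towerP L m (n + 1)) => c₀) :
            BondL2K ℂ d (towerP L m (n + 1)) c₀ W ≃ₗ[ℂ] (Bond d (towerP L m (n + 1)) → W)).toLinearMap ∘ₗ
            G1k L m n φ η U hL α hα1 hU1 hreg τ (c₀ := c₀) (c₁ := c₁) hpos ∘ₗ
            (WL2.linearEquiv ℂ ℂ (fun _ : Bond d (towerP L m (n + 1)) => c₀) :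
            BondL2K ℂ d (towerP L m (n + 1)) c₀ W ≃ₗ[ℂ] (Bond d (towerP L m (n + 1)) → W)).symm.toLinearMap).restrictScalars ℝ) ∘ₗ
        (((WL2.linearEquiv ℂ ℂ (fun _ : Bond d (towerP L m (n + 1)) => c₀) :
            BondL2K ℂ d (towerP L m (n + 1)) c₀ W ≃ₗ[ℂ] (Bond d (towerP L m (n + 1)) → W)).toLinearMap ∘ₗ
            LinearMap.adjoint (QkW L m n φ U hL α hα1 hU1 hreg (c₀ := c₀) (c₁ := c₁)) ∘ₗ
            (WL2.linearEquiv ℂ ℂ (fun _ : Bond d m => c₁) : BondL2K ℂ d m c₁ W ≃ₗ[ℂ] (Bond d m → W)).symm.toLinearMap).restrictScalars ℝ)) ∘ₗ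
        (((WL2.linearEquiv ℂ ℂ (fun _ : Bond d m => c₁) : BondL2K ℂ d m c₁ W ≃ₗ[ℂ] (Bond d m → W)).toLinearMap ∘ₗ
            KinvLatticeK hpos hQ ∘ₗ
            (WL2.linearEquiv ℂ ℂ (fun _ : Bond d m => c₁) : BondL2K ℂ d m c₁ W ≃ₗ[ℂ] (Bond d m → W)).symm.toLinearMap).restrictScalars ℝ)) ∘ₗ LinearMap.id := by
  apply LinearMap.ext
  intro v
  simp only [LinearMap.coe_restrictScalars, LinearMap.coe_comp, Function.comp_apply, LinearEquiv.coe_coe,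
    LinearEquiv.symm_apply_apply, LinearMap.id_coe, id_eq]

end OneHeight

end Literature.MathematicalPhysics.QuantumFieldTheory.Balaban1983to89.Beta.RemainderHasMajH1kTower

end
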